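import Literature.AlgebraicGeometry.HodgeTheory.ComplexAtiyahClass
import HarnessLib

/-!
# Naturality of the Yoneda powers `At(K)^q` of a cochain complex of `𝒪_X`-modules and the
# single-complex anchor `at_j(E[0]) = at_j(E)`, `At(E[0])^q = At(E)^q`

PROMOTED LITERATURE COPY (librarian protocol (b); DEFREQ-CoherentISemiregular, cell pub-hsemireg) of the generic, conjecture-free
`Summits/Ventures/HSemireg/ComplexAtiyahPower.lean` — namespace now `Literature.AlgebraicGeometry.HodgeTheory`, names kept; cell words (seats, ventures) = provenance.

Cell `pub-hsemireg`, general-structure seat gs-g4; SEQUEL to `ComplexAtiyahClass.lean` (p3: `complexAtiyahStep`,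
`complexAtiyahPower`, `toTwistHodgeZeroC`, `extMulAtiyahPower`) and `HigherSigmaOfIso.lean` (gs-g4: the functorial
twisted jet sequences). HONEST FRAMING: infrastructure on the tree's REAL carriers only — NOT a door, NOT a named fact,
NOT a statement about any variety, NOT a «K2 result»: the cell's class-(C) objects (perfect complexes) still have no
tree door, and nothing here says HC, HC_CM or HC_AV is proved. Module-level counterparts: `atiyahClassStep_naturality`,
`atiyahClassPower_naturality` (`HigherSigmaOfIso.lean`); these are the inputs of the conjugation-invariance of a later
`σ_q` for strictly perfect complexes, and the anchor says that `σ_q(E[0])` will restrict to the module `σ_q(E)`.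

CONTENTS (all proved; Mathlib + tree only). For an `S`-scheme `X : Over (Spec S)`, cochain complexes `K, K₁, K₂` of
`𝒪_X`-modules, any `HasDerivedCategory` instance, `Q : C(𝒪_X-Mod) → D(𝒪_X-Mod)`:
* `complexAtiyahStep_comp_mk₀` (the `ShiftedHom.comp` form of p3's `complexAtiyahStep_naturality`) and
  **`complexAtiyahPower_naturality`**: for a chain map `f : K₁ → K₂` and every `q`,
  `At(K₁)^q · (f ⊗ 1_{Ω^q}) = (f ⊗ 1_{Ω⁰}) · At(K₂)^q` as degree-`q` shifted morphisms (induction on `q`);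
* **`atiyahClassC_comp_eq_toTwistHodgeZeroC_comp_complexAtiyahStep`**: `At(K) ≫ (1 ⊗ e₁⁻¹)[1] = ι_K ≫ at_0(K)` — p3's
  untwisted `atiyahClassC K` pushed along `Ω¹ ≅ ⋀¹Ω¹` IS `ι_K` followed by the zeroth twisted step (morphism of short
  exact sequences of complexes `jetToTwistJetComplexHom`, from the new module lemma `jetToTwistJet_naturality`);
* `toTwistHodgeZeroC_f`, `toTwistHodgeZeroC_naturality` (`ι_K : K → K ⊗ Ω⁰` is natural in `K`),
  `complexAtiyahPowerFrom q K = ι_K · At(K)^q : K → (K ⊗ Ω^q)[q]` with `extMulAtiyahPower_eq_comp`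
  (`(x · ι_K) · At^q = x · (ι_K · At^q)`, the argument of BF's `σ_q(x) = tr(x · At^q)/q!`) and
  **`complexAtiyahPowerFrom_naturality`**: `(ι_{K₁} · At(K₁)^q) · (f ⊗ 1) = f · (ι_{K₂} · At(K₂)^q)`;
* CORRECTNESS ANCHOR at the single complex `E[0]` of a module `E`: under the identifications
  `(E[0]) ⊗ Ωⁱ ≅ (E ⊗ Ωⁱ)[0]`, `Pʲ(E[0]) ≅ Pʲ(E)[0]` (Mathlib `singleMapHomologicalComplex`; the morphism of short
  exact sequences of complexes `twistJetComplexShortComplexSingleHom`, via `twistJetι_naturality` /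
  `twistJetπ_naturality`), **`complexAtiyahStep_single`**: `at_j(E[0])` is the image `(atiyahClassStep E j).hom` of
  the tree's module Yoneda class in the derived category (Mathlib `extClass_hom`, `singleδ`, `triangleOfSESδ_naturality`),
  **`complexAtiyahPower_single`**: `At(E[0])^q` is `(atiyahClassPower E q).hom` (induction; Mathlib `Ext.comp_hom`,
  `Ext.mk₀_hom`), and `toTwistHodgeZeroC_single`: `ι_{E[0]}` is `(ι_E)[0]`;
* three reassociation lemmas for `ShiftedHom.comp` with a degree-`0` factor (`shiftedHom_comp_comp_mk₀`,
  `shiftedHom_comp_mk₀_comp`, `shiftedHom_mk₀_comp_comp`; Mathlib has only `mk₀_comp_mk₀_assoc`), and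
  `complexAtiyahPower_zero'` (`At⁰ = mk₀ ((0 : ℕ) : ℤ) _ (𝟙 _)`, the cast form under which `mk₀_comp_mk₀` fires).

WHAT IS NOT HERE: any trace `Ext^{q+2}(K, K ⊗ Ω^q) → H^{q+2}(X, Ω^q)` for complexes (internal Hom complex, its
descent to the derived category, the supertrace); `σ_q` of a complex; anything about semiregularity.

## References
* R.-O. Buchweitz, H. Flenner, *A semiregularity map for modules and applications to deformations*, Compositio
  Math. 137 (2003), §3 (Atiyah class of a complex), §4 (the algebra `A`, `At^k`), Def. 4.1. [BuchweitzFlenner2003]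
* M. F. Atiyah, *Complex analytic connections in fibre bundles*, Trans. AMS 85 (1957), §4 Prop. 6–7. [Atiyah1957]
* R. Hartshorne, *Algebraic Geometry*, GTM 52 (1977), II Ex. 5.1 (a). [Hartshorne1977]
-/

noncomputable section

open CategoryTheory CategoryTheory.Limits CategoryTheory.Abelian AlgebraicGeometry Opposite

namespace Literature.AlgebraicGeometry.HodgeTheory

open Literature.AlgebraicGeometry.Modules Literature.AlgebraicGeometry.Motives
open Literature.AlgebraicGeometry.HodgeTheory
open DerivedCategory

universe w w' u

variable {S : Type u} [CommRing S] {X : Over (Spec (CommRingCat.of S))}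

section Complexes

variable (X) in
/-- `Pʲ(K)` termwise (`twistJetFunctor X j` on a complex; differentials `Pʲ(d)`). [folklore] -/
abbrev twistJetComplex (j : ℕ) (K : CochainComplex X.left.Modules ℤ) : CochainComplex X.left.Modules ℤ :=
  ((twistJetFunctor X j).mapHomologicalComplex (ComplexShape.up ℤ)).obj K

end Complexes

/-! ### Naturality of the powers -/

section Assoc

variable {C : Type*} [Category C] [HasShift C ℤ] {T₁ T₂ T₃ T₄ : C} {a b ab : ℤ}

/-- Reassociation `(α · β) · g = α · (β · g)` for a degree-`0` morphism `g` on the right. [cite: Weibel1994, Def. 10.2.1 and §10.7 (translation functor; Ext and RHom)] -/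
lemma shiftedHom_comp_comp_mk₀ (α : ShiftedHom T₁ T₂ a) (β : ShiftedHom T₂ T₃ b) (g : T₃ ⟶ T₄) (hab : b + a = ab) :
    (α.comp β hab).comp (ShiftedHom.mk₀ (0 : ℤ) rfl g) (zero_add ab) =
      α.comp (β.comp (ShiftedHom.mk₀ (0 : ℤ) rfl g) (zero_add b)) hab :=
  ShiftedHom.comp_assoc _ _ _ hab (zero_add b) (by rw [zero_add, hab])

/-- Reassociation `(α · g) · γ = α · (g · γ)` for a degree-`0` morphism `g` in the middle. [cite: Weibel1994, Def. 10.2.1 and §10.7 (translation functor; Ext and RHom)] -/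
lemma shiftedHom_comp_mk₀_comp (α : ShiftedHom T₁ T₂ a) (g : T₂ ⟶ T₃) (γ : ShiftedHom T₃ T₄ b) (hab : b + a = ab) :
    (α.comp (ShiftedHom.mk₀ (0 : ℤ) rfl g) (zero_add a)).comp γ hab =
      α.comp ((ShiftedHom.mk₀ (0 : ℤ) rfl g).comp γ (add_zero b)) hab :=
  ShiftedHom.comp_assoc _ _ _ (zero_add a) (add_zero b) (by rw [add_zero, hab])

/-- Reassociation `(g · β) · γ = g · (β · γ)` for a degree-`0` morphism `g` on the left. [cite: Weibel1994, Def. 10.2.1 and §10.7 (translation functor; Ext and RHom)] -/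
lemma shiftedHom_mk₀_comp_comp (g : T₁ ⟶ T₂) (β : ShiftedHom T₂ T₃ a) (γ : ShiftedHom T₃ T₄ b) (hab : b + a = ab) :
    (((ShiftedHom.mk₀ (0 : ℤ) rfl g).comp β (add_zero a)).comp γ hab) =
      (ShiftedHom.mk₀ (0 : ℤ) rfl g).comp (β.comp γ hab) (add_zero ab) :=
  ShiftedHom.comp_assoc _ _ _ (add_zero a) hab (by rw [hab, add_zero])

end Assoc

section PowerNaturality

variable [HasDerivedCategory.{w'} X.left.Modules] {K K' : CochainComplex X.left.Modules ℤ}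

variable (K) in
/-- `At(K)⁰ = id`, with the degree written as the cast `((0 : ℕ) : ℤ)` (the form under which `ShiftedHom.mk₀_comp_mk₀`
fires inside inductions on `q`). [cite: BuchweitzFlenner2003, Def. 3.4 (Atiyah class of a complex and its powers)] -/
lemma complexAtiyahPower_zero' :
    complexAtiyahPower X K 0 = ShiftedHom.mk₀ ((0 : ℕ) : ℤ) (by simp) (𝟙 _) := rfl

/-- The twisted step composed with a degree-`0` class on the right, versus on the left: the `ShiftedHom.comp` form
of `complexAtiyahStep_naturality`. [cite: BuchweitzFlenner2003, §3] -/
theorem complexAtiyahStep_comp_mk₀ (j : ℕ) (f : K ⟶ K') :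
    (complexAtiyahStep X j K).comp (ShiftedHom.mk₀ (0 : ℤ) rfl
        (Q.map (((twistHodgeFunctor X (j + 1)).mapHomologicalComplex _).map f))) (zero_add 1) =
      (ShiftedHom.mk₀ (0 : ℤ) rfl
        (Q.map (((twistHodgeFunctor X j).mapHomologicalComplex _).map f))).comp
        (complexAtiyahStep X j K') (add_zero 1) := by
  rw [ShiftedHom.comp_mk₀, ShiftedHom.mk₀_comp]
  exact complexAtiyahStep_naturality X j f

/-- **Naturality of the Yoneda powers of the Atiyah class of complexes**: for a chain map `f : K → K'` and every
`q`, `At(K)^q · (f ⊗ 1_{Ω^q}) = (f ⊗ 1_{Ω⁰}) · At(K')^q` as shifted morphisms of degree `q` (induction on `q` from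
`complexAtiyahStep_naturality`). [cite: BuchweitzFlenner2003, §4 (At^k)] -/
theorem complexAtiyahPower_naturality (f : K ⟶ K') (q : ℕ) :
    (complexAtiyahPower X K q).comp (ShiftedHom.mk₀ (0 : ℤ) rfl
        (Q.map (((twistHodgeFunctor X q).mapHomologicalComplex _).map f))) (zero_add _) =
      (ShiftedHom.mk₀ (0 : ℤ) rfl
        (Q.map (((twistHodgeFunctor X 0).mapHomologicalComplex _).map f))).comp
        (complexAtiyahPower X K' q) (add_zero _) := by
  induction q with
  | zero =>
    simp only [complexAtiyahPower_zero', ShiftedHom.mk₀_comp_mk₀, Category.id_comp, Category.comp_id]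
  | succ q ih =>
    rw [complexAtiyahPower_succ, complexAtiyahPower_succ, shiftedHom_comp_comp_mk₀, complexAtiyahStep_comp_mk₀,
      ← shiftedHom_comp_mk₀_comp, ih, shiftedHom_mk₀_comp_comp]

end PowerNaturality

/-! ### `ι_K : K → K ⊗ Ω⁰` and the powers out of `K` itself -/

section Iota

variable [HasDerivedCategory.{w'} X.left.Modules] (q : ℕ) (K : CochainComplex X.left.Modules ℤ)
  {K₁ K₂ : CochainComplex X.left.Modules ℤ}

omit [HasDerivedCategory.{w'} X.left.Modules] in
/-- The components of `ι_K : K → K ⊗ Ω⁰` are the module maps `ι_{Kⁱ}` (`toTwistHodgeZero`). [cite: Hartshorne1977, II Ex. 5.1 (a)–(b)] -/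
@[simp]
lemma toTwistHodgeZeroC_f (i : ℤ) : (toTwistHodgeZeroC X K).f i = toTwistHodgeZero (K.X i) := by
  dsimp [toTwistHodgeZeroC, Functor.mapHomologicalComplexIdIso]
  exact Category.id_comp _

omit [HasDerivedCategory.{w'} X.left.Modules] in
/-- Naturality of `ι_K` in the complex `K`: `ι_{K₁} ≫ (f ⊗ 1_{Ω⁰}) = f ≫ ι_{K₂}`. [cite: Hartshorne1977, II Ex. 5.1 (a)–(b)] -/
@[reassoc]
theorem toTwistHodgeZeroC_naturality (f : K₁ ⟶ K₂) :
    toTwistHodgeZeroC X K₁ ≫ ((twistHodgeFunctor X 0).mapHomologicalComplex _).map f =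
      f ≫ toTwistHodgeZeroC X K₂ :=
  HomologicalComplex.hom_ext _ _ fun i => by
    simp only [HomologicalComplex.comp_f, toTwistHodgeZeroC_f, Functor.mapHomologicalComplex_map_f]
    exact toTwistHodgeZero_naturality (f.f i)

/-- `ι_K · At(K)^q : K → (K ⊗ Ω^q)[q]` — the Yoneda power of the Atiyah class seen from `K` itself (the shape
composed with a class `x ∈ Ext²(K, K)` in the semiregularity map: `extMulAtiyahPower X K q x = x · (ι_K · At(K)^q)`,
`extMulAtiyahPower_eq_comp`). [cite: BuchweitzFlenner2003, Def. 4.1] -/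
def complexAtiyahPowerFrom : ShiftedHom (Q.obj K) (Q.obj (twistHodgeComplex X q K)) (q : ℤ) :=
  (ShiftedHom.mk₀ (0 : ℤ) rfl (Q.map (toTwistHodgeZeroC X K))).comp (complexAtiyahPower X K q) (add_zero _)

/-- `(x · ι_K) · At(K)^q = x · (ι_K · At(K)^q)`: the argument of `σ_q` factors through `complexAtiyahPowerFrom`.
[cite: BuchweitzFlenner2003, Def. 4.1] -/
theorem extMulAtiyahPower_eq_comp (x : ShiftedHom (Q.obj K) (Q.obj K) (2 : ℤ)) :
    extMulAtiyahPower X K q x = x.comp (complexAtiyahPowerFrom q K) (by ring) :=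
  ShiftedHom.comp_assoc _ _ _ (zero_add 2) (add_zero (q : ℤ)) (by ring)

/-- **Naturality of `ι · At^q`**: `(ι_{K₁} · At(K₁)^q) · (f ⊗ 1_{Ω^q}) = f · (ι_{K₂} · At(K₂)^q)`.
[cite: BuchweitzFlenner2003, §4 (At^k)] -/
theorem complexAtiyahPowerFrom_naturality (f : K₁ ⟶ K₂) :
    (complexAtiyahPowerFrom q K₁).comp (ShiftedHom.mk₀ (0 : ℤ) rfl
        (Q.map (((twistHodgeFunctor X q).mapHomologicalComplex _).map f))) (zero_add _) =
      (ShiftedHom.mk₀ (0 : ℤ) rfl (Q.map f)).comp (complexAtiyahPowerFrom q K₂) (add_zero _) := by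
  unfold complexAtiyahPowerFrom
  rw [shiftedHom_mk₀_comp_comp, complexAtiyahPower_naturality, ← shiftedHom_mk₀_comp_comp,
    ShiftedHom.mk₀_comp_mk₀, ← Functor.map_comp, toTwistHodgeZeroC_naturality, Functor.map_comp,
    ← ShiftedHom.mk₀_comp_mk₀ (Q.map f) _ (add_zero (0 : ℤ)) rfl rfl, shiftedHom_mk₀_comp_comp]

end Iota

/-! ### Correctness anchor: the single complex `E[0]` -/

section Single

open HomologicalComplex

variable (j : ℕ) (E : X.left.Modules)

omit j E in
/-- Naturality of `ι : E ⊗ Ωʲ⁺¹ → Pʲ(E)`: `(g ⊗ 1) ≫ ι_{E₂} = ι_{E₁} ≫ Pʲ(g)`. [cite: Atiyah1957, §4 Prop. 6] -/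
@[reassoc]
lemma twistJetι_naturality {E₁ E₂ : X.left.Modules} (g : E₁ ⟶ E₂) (j : ℕ) :
    twistMap g (hodgeSheaf X (j + 1)) ≫ twistJetι E₂ j = twistJetι E₁ j ≫ twistJetMap g j :=
  (twistJetShortComplexMap g j).comm₁₂

omit j E in
/-- Naturality of `π : Pʲ(E) → E ⊗ Ωʲ`: `Pʲ(g) ≫ π_{E₂} = π_{E₁} ≫ (g ⊗ 1)`. [cite: Atiyah1957, §4 Prop. 6] -/
@[reassoc]
lemma twistJetπ_naturality {E₁ E₂ : X.left.Modules} (g : E₁ ⟶ E₂) (j : ℕ) :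
    twistJetMap g j ≫ twistJetπ E₂ j = twistJetπ E₁ j ≫ twistMap g (hodgeSheaf X j) :=
  (twistJetShortComplexMap g j).comm₂₃

/-- `(E[0]) ⊗ Ωʲ ≅ (E ⊗ Ωʲ)[0]` (Mathlib `singleMapHomologicalComplex`: single complex then functor = functor
then single complex). [folklore] -/
abbrev twistHodgeComplexSingleIso :
    twistHodgeComplex X j ((single X.left.Modules (ComplexShape.up ℤ) 0).obj E) ≅
      (single X.left.Modules (ComplexShape.up ℤ) 0).obj (twistHodge E j) :=
  (singleMapHomologicalComplex (twistHodgeFunctor X j) (ComplexShape.up ℤ) 0).app E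

/-- `Pʲ(E[0]) ≅ Pʲ(E)[0]`. [folklore] -/
abbrev twistJetComplexSingleIso :
    twistJetComplex X j ((single X.left.Modules (ComplexShape.up ℤ) 0).obj E) ≅
      (single X.left.Modules (ComplexShape.up ℤ) 0).obj (twistJetModule E j) :=
  (singleMapHomologicalComplex (twistJetFunctor X j) (ComplexShape.up ℤ) 0).app E

/-- Degree-`0` component of `(E[0]) ⊗ Ωʲ ≅ (E ⊗ Ωʲ)[0]`, on the nose of the module carriers. [cite: Hartshorne1977, II §5 (sheaf Hom, p. 109)] -/
lemma twistHodgeComplexSingleIso_hom_f_zero :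
    (twistHodgeComplexSingleIso j E).hom.f 0 =
      twistMap (singleObjXSelf (ComplexShape.up ℤ) 0 E).hom (hodgeSheaf X j) ≫
        (singleObjXSelf (ComplexShape.up ℤ) 0 (twistHodge E j)).inv :=
  singleMapHomologicalComplex_hom_app_self _ _ 0 E

/-- Degree-`0` component of `Pʲ(E[0]) ≅ Pʲ(E)[0]`, on the nose of the module carriers. [cite: Atiyah1957, §4 Prop. 6–7] -/
lemma twistJetComplexSingleIso_hom_f_zero :
    (twistJetComplexSingleIso j E).hom.f 0 =
      twistJetMap (singleObjXSelf (ComplexShape.up ℤ) 0 E).hom j ≫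
        (singleObjXSelf (ComplexShape.up ℤ) 0 (twistJetModule E j)).inv :=
  singleMapHomologicalComplex_hom_app_self _ _ 0 E

/-- Degree-`0` check for `comm₁₂` of `twistJetComplexShortComplexSingleHom`: `(s ⊗ 1) ≫ ι_E = ι ≫ Pʲ(s)` for the
identification `s : E[0]⁰ ≅ E`. [cite: Atiyah1957, §4 Prop. 6–7] -/
lemma twistJetComplexShortComplexSingleHom_comm₁₂_aux :
    (twistMap (singleObjXSelf (ComplexShape.up ℤ) 0 E).hom (hodgeSheaf X (j + 1)) ≫
        (singleObjXSelf (ComplexShape.up ℤ) 0 (twistHodge E (j + 1))).inv) ≫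
      ((single X.left.Modules (ComplexShape.up ℤ) 0).map (twistJetι E j)).f 0 =
    twistJetι (((single X.left.Modules (ComplexShape.up ℤ) 0).obj E).X 0) j ≫
      twistJetMap (singleObjXSelf (ComplexShape.up ℤ) 0 E).hom j ≫
        (singleObjXSelf (ComplexShape.up ℤ) 0 (twistJetModule E j)).inv := by
  rw [single_map_f_self, Category.assoc, Iso.inv_hom_id_assoc, twistJetι_naturality_assoc]

/-- Degree-`0` check for `comm₂₃` of `twistJetComplexShortComplexSingleHom`: `Pʲ(s) ≫ π_E = π ≫ (s ⊗ 1)`. [cite: Atiyah1957, §4 Prop. 6–7] -/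
lemma twistJetComplexShortComplexSingleHom_comm₂₃_aux :
    (twistJetMap (singleObjXSelf (ComplexShape.up ℤ) 0 E).hom j ≫
        (singleObjXSelf (ComplexShape.up ℤ) 0 (twistJetModule E j)).inv) ≫
      ((single X.left.Modules (ComplexShape.up ℤ) 0).map (twistJetπ E j)).f 0 =
    twistJetπ (((single X.left.Modules (ComplexShape.up ℤ) 0).obj E).X 0) j ≫
      twistMap (singleObjXSelf (ComplexShape.up ℤ) 0 E).hom (hodgeSheaf X j) ≫
        (singleObjXSelf (ComplexShape.up ℤ) 0 (twistHodge E j)).inv := by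
  rw [single_map_f_self, Category.assoc, Iso.inv_hom_id_assoc, twistJetπ_naturality_assoc]

/-- The termwise twisted Atiyah sequence of `E[0]` maps (isomorphically) to the single complex of the twisted
Atiyah sequence of `E`. [folklore] -/
@[simps]
def twistJetComplexShortComplexSingleHom :
    twistJetComplexShortComplex X j ((single X.left.Modules (ComplexShape.up ℤ) 0).obj E) ⟶
      (twistJetShortComplex E j).map (single X.left.Modules (ComplexShape.up ℤ) 0) where
  τ₁ := (twistHodgeComplexSingleIso (j + 1) E).hom
  τ₂ := (twistJetComplexSingleIso j E).hom
  τ₃ := (twistHodgeComplexSingleIso j E).hom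
  comm₁₂ := to_single_hom_ext (by
    rw [comp_f, comp_f, twistHodgeComplexSingleIso_hom_f_zero, twistJetComplexSingleIso_hom_f_zero]
    exact twistJetComplexShortComplexSingleHom_comm₁₂_aux j E)
  comm₂₃ := to_single_hom_ext (by
    rw [comp_f, comp_f, twistHodgeComplexSingleIso_hom_f_zero, twistJetComplexSingleIso_hom_f_zero]
    exact twistJetComplexShortComplexSingleHom_comm₂₃_aux j E)

/-- `ι_{E[0]}` is `ι_E` in degree `0`: `ι_{E[0]} ≫ ((E[0]) ⊗ Ω⁰ ≅ (E ⊗ Ω⁰)[0]) = (ι_E)[0]`. [cite: Hartshorne1977, II Ex. 5.1 (a)–(b)] -/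
theorem toTwistHodgeZeroC_single :
    toTwistHodgeZeroC X ((single X.left.Modules (ComplexShape.up ℤ) 0).obj E) ≫ (twistHodgeComplexSingleIso 0 E).hom =
      (single X.left.Modules (ComplexShape.up ℤ) 0).map (toTwistHodgeZero E) :=
  to_single_hom_ext (by
    rw [comp_f, toTwistHodgeZeroC_f, twistHodgeComplexSingleIso_hom_f_zero, single_map_f_self]
    exact (Category.assoc _ _ _).symm.trans ((congrArg (· ≫ (singleObjXSelf (ComplexShape.up ℤ) 0 _).inv)
      (toTwistHodgeZero_naturality (singleObjXSelf (ComplexShape.up ℤ) 0 E).hom)).trans (Category.assoc _ _ _)))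

variable [HasDerivedCategory.{w'} X.left.Modules]

/-- **`at_j(E[0])` is the module Atiyah step `at_j(E)`**: under the identifications `(E[0]) ⊗ Ωⁱ ≅ (E ⊗ Ωⁱ)[0]`,
the complex-level twisted step of the single complex `E[0]` is the image `(atiyahClassStep E j).hom` in the derived
category of the tree's module class (Mathlib `ShortExact.extClass_hom`, `singleδ`, `triangleOfSESδ_naturality`).
[cite: BuchweitzFlenner2003, §3–§4] -/
theorem complexAtiyahStep_single :
    complexAtiyahStep X j ((single X.left.Modules (ComplexShape.up ℤ) 0).obj E) ≫
        (Q.map (twistHodgeComplexSingleIso (j + 1) E).hom)⟦(1 : ℤ)⟧' =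
      Q.map (twistHodgeComplexSingleIso j E).hom ≫ (atiyahClassStep E j).hom := by
  refine (triangleOfSESδ_naturality (twistJetComplexShortComplex_shortExact j _)
    ((twistJetShortComplex_shortExact E j).map_of_exact
      (HomologicalComplex.single X.left.Modules (ComplexShape.up ℤ) 0))
    (twistJetComplexShortComplexSingleHom j E)).trans ?_
  change _ = _ ≫ (twistJetShortComplex_shortExact E j).extClass.hom
  rw [ShortComplex.ShortExact.extClass_hom]
  simp only [ShortComplex.ShortExact.singleδ, Functor.mapIso_hom, Functor.mapIso_inv,
    SingleFunctors.evaluation_map, DerivedCategory.singleFunctorsPostcompQIso_hom_hom,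
    DerivedCategory.singleFunctorsPostcompQIso_inv_hom, NatTrans.id_app]
  erw [CategoryTheory.Functor.map_id, Category.comp_id, Category.id_comp]
  rfl

/-- `ShiftedHom.comp` form of `complexAtiyahStep_single`. [cite: BuchweitzFlenner2003, §3–§4] -/
theorem complexAtiyahStep_single_comp :
    (complexAtiyahStep X j ((single X.left.Modules (ComplexShape.up ℤ) 0).obj E)).comp
        (ShiftedHom.mk₀ (0 : ℤ) rfl
          (Q.map (twistHodgeComplexSingleIso (j + 1) E).hom)) (zero_add 1) =
      (ShiftedHom.mk₀ (0 : ℤ) rfl (Q.map (twistHodgeComplexSingleIso j E).hom)).comp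
        (atiyahClassStep E j).hom (add_zero _) := by
  rw [ShiftedHom.comp_mk₀, ShiftedHom.mk₀_comp]
  exact complexAtiyahStep_single j E

/-- **`At(E[0])^q` is the module power `At(E)^q`**: under the identifications `(E[0]) ⊗ Ωⁱ ≅ (E ⊗ Ωⁱ)[0]`, the
complex-level Yoneda power of the single complex `E[0]` is the image `(atiyahClassPower E q).hom` in the derived
category of the tree's module power (induction on `q`; Mathlib `Ext.comp_hom`, `Ext.mk₀_hom`).
[cite: BuchweitzFlenner2003, §4 (At^k)] -/
theorem complexAtiyahPower_single (q : ℕ) :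
    (complexAtiyahPower X ((single X.left.Modules (ComplexShape.up ℤ) 0).obj E) q).comp
        (ShiftedHom.mk₀ (0 : ℤ) rfl
          (Q.map (twistHodgeComplexSingleIso q E).hom)) (zero_add _) =
      (ShiftedHom.mk₀ (0 : ℤ) rfl (Q.map (twistHodgeComplexSingleIso 0 E).hom)).comp
        (atiyahClassPower E q).hom (add_zero _) := by
  induction q with
  | zero =>
    rw [complexAtiyahPower_zero', atiyahClassPower_zero, Ext.mk₀_hom, CategoryTheory.Functor.map_id,
      ShiftedHom.mk₀_comp_mk₀, Category.id_comp]
    erw [ShiftedHom.mk₀_comp_mk₀, Category.comp_id]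
    rfl
  | succ q ih =>
    rw [complexAtiyahPower_succ, atiyahClassPower_succ, Ext.comp_hom, shiftedHom_comp_comp_mk₀,
      complexAtiyahStep_single_comp]
    erw [← shiftedHom_comp_mk₀_comp]
    rw [ih]
    erw [shiftedHom_mk₀_comp_comp]
    rfl

end Single

/-! ### The Atiyah class of a complex is its zeroth twisted step: `At(K) · e₁⁻¹ = ι_K · at_0(K)` -/

section StepZero

variable {E₁ E₂ : X.left.Modules}

/-- Naturality in `E` of `𝓗om(E^∨, Ω¹) → 𝓗om(E^∨, ⋀¹ Ω¹)` (post-composition with `e₁⁻¹ : Ω¹ ≅ ⋀¹ Ω¹` commutes with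
the pre-composition `g ⊗ 1`). [cite: Hartshorne1977, II §5 (sheaf Hom, p. 109)] -/
@[reassoc]
lemma twistMap_comp_sheafHomMap_hodgeSheafOneIso_inv (g : E₁ ⟶ E₂) :
    twistMap g (cotangentSheaf X) ≫ sheafHomMap (dual E₂) (hodgeSheafOneIso X).inv =
      sheafHomMap (dual E₁) (hodgeSheafOneIso X).inv ≫ twistMap g (hodgeSheaf X 1) :=
  sheafHomPrecomp_comp_sheafHomMap _ _

/-- **Naturality in `E` of the comparison `P¹(E) → P⁰-twisted jet module`**: `P¹(g) ≫ c_{E₂} = c_{E₁} ≫ P⁰(g)`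
(on sections: `ι (g s) = (g ⊗ 1)(ι s)` and `(g ⊗ 1)(β) ≫ e₁⁻¹ = (g ⊗ 1)(β ≫ e₁⁻¹)`). [cite: Atiyah1957, §4 Prop. 6] -/
@[reassoc]
lemma jetToTwistJet_naturality (g : E₁ ⟶ E₂) :
    jetMap g ≫ jetToTwistJet E₂ = jetToTwistJet E₁ ≫ twistJetMap g 0 := by
  refine Scheme.Modules.hom_ext _ _ fun U => AddCommGrpCat.ext fun (p : JetSections E₁ U) => ?_
  change (jetToTwistJet E₂).app U ((jetMap g).app U p) = (twistJetMap g 0).app U ((jetToTwistJet E₁).app U p)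
  rw [jetToTwistJet_app_apply, jetToTwistJet_app_apply, twistJetMap_app_apply]
  refine TwistJetSections.ext ?_ ?_
  · exact (congrArg (fun φ => φ.app U p.fst) (toTwistHodgeZero_naturality g)).symm
  · change (twistMap g (cotangentSheaf X)).app U p.snd ≫ _ =
      (twistMap g (hodgeSheaf X 1)).app U (p.snd ≫ _)
    rw [sheafHomPrecomp_app_apply, sheafHomPrecomp_app_apply, Category.assoc]

variable (K : CochainComplex X.left.Modules ℤ)

/-- The morphism of short exact sequences of complexes from the Atiyah sequence `0 → K ⊗ Ω¹ → P¹(K) → K → 0` to the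
`Ω⁰`-twisted one `0 → K ⊗ ⋀¹Ω¹ → P⁰(K) → K ⊗ Ω⁰ → 0`, termwise the module morphism `jetToTwistJetHom`. [folklore] -/
def jetToTwistJetComplexHom : jetShortComplexC K ⟶ twistJetComplexShortComplex X 0 K where
  τ₁ := { f := fun i => sheafHomMap (dual (K.X i)) (hodgeSheafOneIso X).inv
          comm' := fun i i' _ => (twistMap_comp_sheafHomMap_hodgeSheafOneIso_inv (K.d i i')).symm }
  τ₂ := { f := fun i => jetToTwistJet (K.X i)
          comm' := fun i i' _ => (jetToTwistJet_naturality (K.d i i')).symm }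
  τ₃ := toTwistHodgeZeroC X K
  comm₁₂ := HomologicalComplex.hom_ext _ _ fun i => (jetToTwistJetHom (K.X i)).comm₁₂
  comm₂₃ := HomologicalComplex.hom_ext _ _ fun i => by
    rw [HomologicalComplex.comp_f, HomologicalComplex.comp_f, toTwistHodgeZeroC_f]
    exact (jetToTwistJetHom (K.X i)).comm₂₃

variable [HasDerivedCategory.{w'} X.left.Modules]

/-- **The Atiyah class of a complex is its zeroth twisted step**: `At(K) ≫ (1 ⊗ e₁⁻¹)[1] = ι_K ≫ at_0(K)` in the
derived category — p3's `atiyahClassC K : K → (K ⊗ Ω¹)[1]` pushed along `Ω¹ ≅ ⋀¹ Ω¹` equals `ι_K : K → K ⊗ Ω⁰`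
followed by `complexAtiyahStep X 0 K` (complex-level form of the module lemma `atiyahClass_comp_hodgeSheafOneIso_inv`;
Mathlib `triangleOfSESδ_naturality` for `jetToTwistJetComplexHom`). [cite: BuchweitzFlenner2003, §3 (Atiyah class)] -/
theorem atiyahClassC_comp_eq_toTwistHodgeZeroC_comp_complexAtiyahStep :
    atiyahClassC K ≫ (Q.map (jetToTwistJetComplexHom K).τ₁)⟦(1 : ℤ)⟧' =
      Q.map (toTwistHodgeZeroC X K) ≫ complexAtiyahStep X 0 K :=
  triangleOfSESδ_naturality _ _ (jetToTwistJetComplexHom K)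

end StepZero

end Literature.AlgebraicGeometry.HodgeTheory

end
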